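import Summits.CriticalPhenomena.SAWScalingLimit.Theses.SAWDeterminantalDiagonal

/-!
# `TargetFromCruxes` (stmt-CriticalPhenomena-14274): the cruxes of `SAWDeterminantalDiagonal` give its target

Support item stmt-CriticalPhenomena-14274 (route-choice repair, option (a)): the four cruxes `NeutralRestriction`,
`DiscrepancyConfCov`, `DiagonalUniversality`, `DiscrepancySimple` with the supports `LSWSimpleRestrictionIsSLE`,
`RestrictionOfDiagLimit` imply `Target = (DW) ∧ (U)`.  (U) is `DiagonalUniversality` verbatim; (DW) at the fugacity `x`
produced by `DiscrepancyConfCov`: `RestrictionOfDiagLimit` fed with `NeutralRestriction` gives the restriction property of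
the limit family `P`, `DiscrepancySimple` its simple-curve clause, `LSWSimpleRestrictionIsSLE` then `IsSLELaw (8/3) D (P D)`,
i.e. `P D` is the push-forward of Wiener measure under a chordal SLE_{8/3} curve; `integral_map` converts the convergence of
test integrals to `P D` into `ConvergesInLawToSLE (8/3)`.  The term of the route's certified deciding theorem `closes` with
the pair constructor in front; pure logic.  [cite: LawlerSchrammWerner2003Restriction, Thm 8.4]
-/

namespace Summit.CriticalPhenomena.SAWScalingLimit.Theorems

open Summit.CriticalPhenomena.SAWScalingLimit.Theses

/-- **`TargetFromCruxes` (stmt-CriticalPhenomena-14274)** of route `SAWDeterminantalDiagonal`: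
`NeutralRestriction → DiscrepancyConfCov → DiagonalUniversality → DiscrepancySimple → LSWSimpleRestrictionIsSLE →
RestrictionOfDiagLimit → Target`. [cite: LawlerSchrammWerner2003Restriction, Thm 8.4] -/
theorem DetDiagTargetFromCruxes_proof : SAWDeterminantalDiagonal.TargetFromCruxes := by
  intro hNR hCC hDU hSimple hLSW hRes
  refine ⟨?_, hDU⟩
  obtain ⟨x, hx, P, hPch, hlim, hcov⟩ := hCC
  have hres : P.IsRestriction := hRes hNR x hx P hPch hlim hcov
  have hsimple := hSimple x hx P hPch hlim hcov hres
  have hsle : ∀ D : Literature.Probability.RandomPlanarGeometry.DobrushinDomain,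
      Literature.Probability.RandomPlanarGeometry.IsSLELaw ((8 : NNReal) / 3) D (P D) :=
    hLSW P hPch hcov hres hsimple
  refine ⟨x, hx, ?_⟩
  intro D a b hab
  obtain ⟨Γ, hΓ, hPD⟩ := hsle D
  refine ⟨Γ, hΓ, Filter.Eventually.of_forall fun δ =>
    (Literature.Probability.RandomPlanarGeometry.SAW.DomainSAW.measurable_of_top _).aemeasurable,
    fun f => ?_⟩
  have h := hlim D a b hab f
  have e : (∫ ω, f (id ω) ∂(P D)) =
      ∫ ω, f (Γ ω) ∂Literature.Probability.Process.preWienerMeasure := by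
    rw [hPD]
    exact MeasureTheory.integral_map hΓ.aemeasurable f.continuous.aestronglyMeasurable
  rw [e] at h
  exact h

end Summit.CriticalPhenomena.SAWScalingLimit.Theorems
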